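import Summits.HodgeConjecture.HodgeConjecture.Theorems.K2E3AbelianLayerEigencharacters   -- ★ p855655 (this seat): eigencharacter spaces of a commuting finite-order family, independence, common eigenvectors, permutation by normalising operators
import Mathlib.RingTheory.SimpleModule.Isotypic
import Mathlib.RepresentationTheory.Maschke
import Mathlib.RepresentationTheory.Subrepresentation
import HarnessLib

/-!
# Crux `H413` — K2-LIT E3 «EllipticInputs», U12-h brick (Cl) part 2: CLIFFORD ON AN ABELIAN LAYER — the eigencharacters of a normalised commuting layer occurring in an
# ISOTYPIC representation of a finite group form ONE orbit under the normalising group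

Cell `hodgecm-mathlib`, Track B «K2-LIT», crux item `stmt-HodgeConjecture-24833` (h413), line `K2_E3_EllipticInputs`, unit U12 «HC characters», socket U12-h
`sig_K2E3CharLocConstNearRegular` (‹#9L›).  Seat K2E3-p09 (g2), 9L line lead; brick (Cl) part 2 of memo v4 `K2/K2E3-p09/g2/MEMO-U12h-HF-bricks.v4.K2E3-p09-g2.md` (depth-halving road,
K2E1b-p08 (g2) MEMO (H2) d8755e6223fd3317 §1 (C1)(ii)); `--supports stmt-HodgeConjecture-24833 --as helper`.  THEOREMS ONLY — no `def`, no named fact, no instance, no notation, no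
`sorry`.  GENERIC: `k` algebraically closed of characteristic `0`, `σ` a representation of a FINITE group `Q` on a finite-dimensional `k`-space `C`, a «layer» `s : ι → Q` whose operators
`σ(s i)` commute, normalised by a group `κ` acting on `Q` through `u : κ →* Q` (onto) and on the indices through `π : κ →* Perm ι` with `u(x) s(i) u(x)⁻¹ = s(π x i)`.  HONEST LABEL: HC_CM is
proved only modulo the 7 printed citations (2 remaining named inputs: hLiu418 = stmt-HodgeConjecture-24832, h413 = stmt-HodgeConjecture-24833) until rung 0 closes; count-neutral engine.

THE MATHEMATICS ([Serre1977] §8.1 Prop. 24 (Clifford's theorem for an abelian normal subgroup); the use in Harish-Chandra's finiteness argument [HarishChandra1999] §17 Thm. 17.1 («the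
`K^{1/2}`-orbit `𝒪_d`») and p. 85).  In the application (memo v4 §1): `C = c` is a `K₁`-type (isotypic component of a level space), `Q = K₁ ∕ ker`, `κ = K₁`, `u = φ`, `ι = A = K_{N′}`
(the abelian layer modulo the depth), `s = φ|_A`, `π x = Ad(x)|_A`.  With `C_χ := ⋂_i ker(σ(s i) − χ i)` the eigencharacter spaces (★ p855655: `C = ⊕_χ C_χ`):
* §1 `σ(u x)` maps `C_χ` onto `C_{x·χ}`, `x·χ := χ ∘ (π x)⁻¹` (`apply_mem_iInf_eigenspace_orbit`); hence `M := ⨆_{x ∈ κ} C_{x·χ₁}` is a `σ(Q)`-stable subspace (`apply_mem_iSup_orbit`),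
  i.e. a subrepresentation; and a non-zero vector of `⨆_x C_{x·χ₁}` lying in some `C_χ` has `χ` in the orbit (`exists_eq_orbit_of_mem_iSup`, independence ★ p855655).
* §2 **`exists_eq_comp_symm_of_ne_bot` — ONE ORBIT**: if `σ` is ISOTYPIC (all simple `k[Q]`-submodules of `C` isomorphic; Mathlib `IsIsotypic`) and `C_{χ₁} ≠ 0`, `C_{χ₂} ≠ 0`, then
  `χ₂ = χ₁ ∘ (π x)⁻¹` for some `x ∈ κ`.  Proof: the subrepresentation `M` is non-zero; if its `k[Q]`-complement `M′` (Maschke) were non-zero, simple submodules `S ≤ M`, `S′ ≤ M′`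
  would be isomorphic (isotypy); a common eigenvector `v ∈ S` (★ p855655 `exists_common_eigenvector_of_invariant`) has its character in the orbit (`v ∈ M`), and its image in `S′`
  is a common eigenvector with the SAME character (the isomorphism is `k[Q]`-linear), hence lies in `M ∩ M′ = 0` — contradiction.  So `M = C` and every occurring `χ₂` is in the orbit.
  In Harish-Chandra's words: the characters of `A` occurring in an irreducible (here: isotypic) `d ∈ ℰ(K₁)` form a single `K₁`-orbit — so the parameters `X₁` (from INT), `X₃` (from
  OCC) and the depth witness all lie in ONE `Ad(K₁)`-orbit, which is what lets ★ L6 `mul_norm_proj_le_of_eq_add` ∕ `false_of_cone_near_submodule` compare them.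
* §3 `isIsotypic_asModule_toRepresentation_ofSubmodule'` — docking lemma for (It): for an isotypic component `c` of `V^{K′}` under `τ(Q)` (★ p855602's HF data), the restricted
  representation `(Subrepresentation.ofSubmodule' c).toRepresentation` on `c` is isotypic in the above sense.

## References
* [Serre1977] J.-P. Serre, *Linear Representations of Finite Groups*, GTM 42 (1977): §8.1 Prop. 24 (restriction to an abelian normal subgroup; Clifford), §2.6 Thm. 8.
* [HarishChandra1999] Harish-Chandra (notes by S. DeBacker and P. J. Sally, Jr.), *Admissible Invariant Distributions on Reductive p-adic Groups*, ULECT 16, AMS (1999): §17 Thm. 17.1,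
  Cor. 17.2, p. 85.
-/

set_option autoImplicit false
-- the mandated namespace repeats `HodgeConjecture.HodgeConjecture`, as in every `Theorems/*.lean` of this sub-problem
set_option linter.dupNamespace false

noncomputable section

open Module Set
open Summit.HodgeConjecture.HodgeConjecture.Cruxes.H413.K2E3AbelianLayerEigencharacters

namespace Summit.HodgeConjecture.HodgeConjecture.Cruxes.H413.K2E3AbelianLayerClifford

variable {k C Q ι κ : Type*} [Field k] [AddCommGroup C] [Module k C] [Group Q] [Group κ]
  (σ : Representation k Q C) (s : ι → Q) (u : κ →* Q) (π : κ →* Equiv.Perm ι)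

/-! ## §1 The normalising group permutes the eigencharacter spaces; the orbit subspace `⨆_x C_{x·χ}` -/

section Orbit

/-- `σ(u x) ∘ σ(s i) = σ(s (π x i)) ∘ σ(u x)` from `u(x) s(i) u(x)⁻¹ = s(π x i)`. [cite: Serre1977, §8.1 Prop. 24] -/
theorem rep_mul_rep_layer_eq (hconj : ∀ (x : κ) (i : ι), u x * s i * (u x)⁻¹ = s (π x i)) (x : κ) (i : ι) :
    σ (u x) * σ (s i) = σ (s (π x i)) * σ (u x) := by
  rw [← map_mul, ← map_mul, ← hconj x i, inv_mul_cancel_right]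

/-- **`σ(u x)(C_χ) ⊆ C_{x·χ}`, `x·χ = χ ∘ (π x)⁻¹`** (★ p855655 `apply_mem_iInf_eigenspace_comp_symm`). [cite: Serre1977, §8.1 Prop. 24] -/
theorem apply_mem_iInf_eigenspace_orbit (hconj : ∀ (x : κ) (i : ι), u x * s i * (u x)⁻¹ = s (π x i)) (x : κ) {χ : ι → k} {w : C}
    (hw : w ∈ ⨅ i, Module.End.eigenspace (σ (s i)) (χ i)) : σ (u x) w ∈ ⨅ i, Module.End.eigenspace (σ (s i)) ((χ ∘ ⇑(π x).symm) i) :=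
  apply_mem_iInf_eigenspace_comp_symm (fun i => σ (s i)) (π x) (rep_mul_rep_layer_eq σ s u π hconj x) hw

/-- The orbit relation composes: `(χ ∘ (π y)⁻¹) ∘ (π x)⁻¹ = χ ∘ (π (x y))⁻¹`. [folklore] -/
theorem comp_symm_comp_symm {β : Type*} (χ : ι → β) (x y : κ) : (χ ∘ ⇑(π y).symm) ∘ ⇑(π x).symm = χ ∘ ⇑(π (x * y)).symm := by
  funext j
  rw [map_mul]
  rfl

/-- **The orbit subspace `M := ⨆_{y ∈ κ} C_{y·χ}` is stable under `σ(u x)`** for every `x ∈ κ` (so under `σ(Q)` when `u` is onto): `σ(u x) C_{y·χ} ⊆ C_{(xy)·χ}`. [cite: Serre1977, §8.1 Prop. 24] -/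
theorem apply_mem_iSup_orbit (hconj : ∀ (x : κ) (i : ι), u x * s i * (u x)⁻¹ = s (π x i)) (χ : ι → k) (x : κ) {w : C}
    (hw : w ∈ ⨆ y : κ, ⨅ i, Module.End.eigenspace (σ (s i)) ((χ ∘ ⇑(π y).symm) i)) : σ (u x) w ∈ ⨆ y : κ, ⨅ i, Module.End.eigenspace (σ (s i)) ((χ ∘ ⇑(π y).symm) i) := by
  refine Submodule.iSup_induction (motive := fun w => σ (u x) w ∈ ⨆ y : κ, ⨅ i, Module.End.eigenspace (σ (s i)) ((χ ∘ ⇑(π y).symm) i)) _ hw (fun y w hw => ?_)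
    (by rw [map_zero]; exact Submodule.zero_mem _) fun a b ha hb => by rw [map_add]; exact Submodule.add_mem _ ha hb
  have h := apply_mem_iInf_eigenspace_orbit σ s u π hconj x hw
  rw [comp_symm_comp_symm π χ x y] at h
  exact Submodule.mem_iSup_of_mem (x * y) h

variable [IsAlgClosed k] [CharZero k] [FiniteDimensional k C]

omit [IsAlgClosed k] [FiniteDimensional k C] in
/-- **A non-zero common eigenvector inside the orbit subspace has its character in the orbit**: `v ∈ ⨆_y C_{y·χ₁}`, `v ∈ C_χ`, `v ≠ 0` ⇒ `χ = y·χ₁` for some `y` (independence of the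
eigencharacter spaces, ★ p855655 `iSupIndep_iInf_eigenspace`, Mathlib `iSupIndep.disjoint_biSup`). [cite: Serre1977, §2.6 Thm. 8] -/
theorem exists_eq_orbit_of_mem_iSup (hcomm : ∀ i j, Commute (σ (s i)) (σ (s j))) (hfin : ∀ i, ∃ n : ℕ, 0 < n ∧ σ (s i) ^ n = 1) (χ₁ : ι → k)
    {χ : ι → k} {v : C} (hvM : v ∈ ⨆ y : κ, ⨅ i, Module.End.eigenspace (σ (s i)) ((χ₁ ∘ ⇑(π y).symm) i)) (hvχ : v ∈ ⨅ i, Module.End.eigenspace (σ (s i)) (χ i))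
    (hv : v ≠ 0) : ∃ y : κ, χ = χ₁ ∘ ⇑(π y).symm := by
  by_contra h
  push Not at h
  have hnot : χ ∉ Set.range fun y : κ => χ₁ ∘ ⇑(π y).symm := by
    rintro ⟨y, hy⟩
    exact h y hy.symm
  have hdis := (iSupIndep_iInf_eigenspace (fun i => σ (s i)) hcomm hfin).disjoint_biSup hnot
  have hle : (⨆ y : κ, ⨅ i, Module.End.eigenspace (σ (s i)) ((χ₁ ∘ ⇑(π y).symm) i)) ≤
      ⨆ χ' ∈ Set.range (fun y : κ => χ₁ ∘ ⇑(π y).symm), ⨅ i, Module.End.eigenspace (σ (s i)) (χ' i) :=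
    iSup_le fun y => le_biSup (fun χ' : ι → k => ⨅ i, Module.End.eigenspace (σ (s i)) (χ' i)) ⟨y, rfl⟩
  exact hv ((Submodule.disjoint_def.1 hdis) v hvχ (hle hvM))

end Orbit

/-! ## §2 ONE ORBIT on an isotypic representation -/

section OneOrbit

variable [IsAlgClosed k] [CharZero k] [FiniteDimensional k C] [Finite Q]

omit [IsAlgClosed k] [CharZero k] [FiniteDimensional k C] [Group κ] in
/-- The layer operators have finite order (`Q` finite), hence the hypotheses of ★ p855655 apply. [folklore] -/
theorem exists_pow_rep_layer_eq_one (i : ι) : ∃ n : ℕ, 0 < n ∧ σ (s i) ^ n = 1 :=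
  ⟨Nat.card Q, Nat.card_pos, by rw [← map_pow, pow_card_eq_one', map_one]⟩

/-- **CLIFFORD, ONE ORBIT: on an ISOTYPIC representation of the finite group `Q`, the occurring eigencharacters of a normalised commuting layer form a single orbit of the normalising
group.**  `σ` isotypic (Mathlib `IsIsotypic (MonoidAlgebra k Q) σ.asModule`: all simple `k[Q]`-submodules are isomorphic — e.g. `σ` irreducible, or an isotypic component of any
representation), `u : κ ↠ Q`, `π : κ →* Perm ι` with `u(x) s(i) u(x)⁻¹ = s(π x i)`, the `σ(s i)` pairwise commuting.  If `C_{χ₁} ≠ 0` and `C_{χ₂} ≠ 0` then `χ₂ = χ₁ ∘ (π x)⁻¹` for some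
`x ∈ κ`.  (§1 and the module docstring for the proof.)  In the application: the characters `χ_X|_A` of the abelian layer `A = K_{N′}` occurring in a `K₁`-type `d` form ONE `Ad(K₁)`-orbit of
parameters `X` — Harish-Chandra's orbit `𝒪_d`, restricted to what the depth-halving argument needs. [cite: Serre1977, §8.1 Prop. 24] [cite: HarishChandra1999, §17 Thm. 17.1 and p. 85] -/
theorem exists_eq_comp_symm_of_ne_bot (hiso : IsIsotypic (MonoidAlgebra k Q) σ.asModule) (hu : Function.Surjective u)
    (hconj : ∀ (x : κ) (i : ι), u x * s i * (u x)⁻¹ = s (π x i)) (hcomm : ∀ i j, Commute (σ (s i)) (σ (s j)))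
    {χ₁ χ₂ : ι → k} (h₁ : (⨅ i, Module.End.eigenspace (σ (s i)) (χ₁ i)) ≠ ⊥) (h₂ : (⨅ i, Module.End.eigenspace (σ (s i)) (χ₂ i)) ≠ ⊥) :
    ∃ x : κ, χ₂ = χ₁ ∘ ⇑(π x).symm := by
  classical
  have hfin : ∀ i, ∃ n : ℕ, 0 < n ∧ σ (s i) ^ n = 1 := exists_pow_rep_layer_eq_one σ s
  haveI : NeZero (Nat.card Q : k) := ⟨Nat.cast_ne_zero.2 Nat.card_pos.ne'⟩
  -- the orbit subspace `M` as a subrepresentation, and its `k[Q]`-submodule avatar `N`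
  let M : Submodule k C := ⨆ y : κ, ⨅ i, Module.End.eigenspace (σ (s i)) ((χ₁ ∘ ⇑(π y).symm) i)
  have hMstab : ∀ (q : Q) ⦃w : C⦄, w ∈ M → σ q w ∈ M := fun q w hw => by
    obtain ⟨x, rfl⟩ := hu q
    exact apply_mem_iSup_orbit σ s u π hconj χ₁ x hw
  let Msub : Subrepresentation σ := ⟨M, hMstab⟩
  let N : Submodule (MonoidAlgebra k Q) σ.asModule := Msub.asSubmodule
  have hN : ∀ {w : C}, σ.asModuleEquiv.symm w ∈ N ↔ w ∈ M := fun {w} => Iff.rfl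
  -- `C_{χ₁} ≤ M` (`y = 1`)
  have hχ₁M : (⨅ i, Module.End.eigenspace (σ (s i)) (χ₁ i)) ≤ M := by
    have h1 : (χ₁ ∘ ⇑(π 1).symm) = χ₁ := by funext j; rw [map_one]; rfl
    have := le_iSup (fun y : κ => ⨅ i, Module.End.eigenspace (σ (s i)) ((χ₁ ∘ ⇑(π y).symm) i)) 1
    rwa [h1] at this
  -- `N = ⊤`
  have hNtop : N = ⊤ := by
    by_contra hNtop
    obtain ⟨N', hNN'⟩ := MonoidAlgebra.Submodule.exists_isCompl N
    have hN'ne : N' ≠ ⊥ := by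
      intro h
      apply hNtop
      have := hNN'.sup_eq_top
      rwa [h, sup_bot_eq] at this
    -- simple submodules `S ≤ N`, `S' ≤ N'`, and a `k[Q]`-isomorphism `e : S ≃ S'`
    have hNne : N ≠ ⊥ := by
      intro h
      obtain ⟨w, hw, hw0⟩ := Submodule.exists_mem_ne_zero_of_ne_bot h₁
      have hwN : σ.asModuleEquiv.symm w ∈ N := hN.2 (hχ₁M hw)
      rw [h, Submodule.mem_bot, LinearEquiv.map_eq_zero_iff] at hwN
      exact hw0 hwN
    obtain ⟨S, hSN, hS⟩ := (IsSemisimpleModule.eq_bot_or_exists_simple_le N).resolve_left hNne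
    obtain ⟨S', hS'N', hS'⟩ := (IsSemisimpleModule.eq_bot_or_exists_simple_le N').resolve_left hN'ne
    obtain ⟨e⟩ : Nonempty (S ≃ₗ[MonoidAlgebra k Q] S') := hiso S' S
    -- a common eigenvector `v ∈ S` of the layer
    let SW : Submodule k C := (Submodule.restrictScalars k S).comap σ.asModuleEquiv.symm.toLinearMap
    have hSWmem : ∀ {w : C}, w ∈ SW ↔ σ.asModuleEquiv.symm w ∈ S := fun {w} => Iff.rfl
    have hSW : SW ≠ ⊥ := by
      haveI : Nontrivial S := IsSimpleModule.nontrivial (MonoidAlgebra k Q) S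
      obtain ⟨y, hy⟩ := exists_ne (0 : S)
      intro h
      have hy' : σ.asModuleEquiv (y : σ.asModule) ∈ SW := by
        rw [hSWmem, LinearEquiv.symm_apply_apply]
        exact y.2
      rw [h, Submodule.mem_bot, LinearEquiv.map_eq_zero_iff] at hy'
      exact hy (Subtype.ext hy')
    have hSinv : ∀ i, ∀ w ∈ SW, σ (s i) w ∈ SW := fun i w hw =>
      hSWmem.2 ((Subrepresentation.ofSubmodule' S).apply_mem_toSubmodule (s i) (hSWmem.1 hw))
    obtain ⟨χ, v, hvS, hv0, hv⟩ := exists_common_eigenvector_of_invariant (fun i => σ (s i)) hcomm hfin hSW hSinv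
    -- its character lies in the orbit (`v ∈ S ≤ N = M`)
    have hvM : v ∈ M := hN.1 (hSN (hSWmem.1 hvS))
    have hvχ : v ∈ ⨅ i, Module.End.eigenspace (σ (s i)) (χ i) := (Submodule.mem_iInf _).2 fun i => Module.End.mem_eigenspace_iff.2 (hv i)
    obtain ⟨y, rfl⟩ := exists_eq_orbit_of_mem_iSup σ s π hcomm hfin χ₁ hvM hvχ hv0
    -- transport `v` to `S'` along `e`: the image `v'` is a common eigenvector with the SAME character
    let vS : S := ⟨σ.asModuleEquiv.symm v, hSWmem.1 hvS⟩
    let v' : C := σ.asModuleEquiv ((e vS : S') : σ.asModule)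
    have hev : ∀ i, σ (s i) v' = (χ₁ ∘ ⇑(π y).symm) i • v' := fun i => by
      -- in `S`: `single (s i) 1 • vS = (χ₁∘…) i • vS`
      have h1 : (MonoidAlgebra.single (s i) (1 : k) • vS : S) = algebraMap k (MonoidAlgebra k Q) ((χ₁ ∘ ⇑(π y).symm) i) • vS := by
        apply Subtype.ext
        rw [Submodule.coe_smul, Submodule.coe_smul, Representation.single_smul, one_smul, algebraMap_smul]
        exact hv i
      -- apply `e` (which is `k[Q]`-linear)
      have h2 : (MonoidAlgebra.single (s i) (1 : k) • e vS : S') = algebraMap k (MonoidAlgebra k Q) ((χ₁ ∘ ⇑(π y).symm) i) • e vS := by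
        rw [← LinearEquiv.map_smul, h1, LinearEquiv.map_smul]
      -- read it in `C`
      have h3 := congrArg (fun z : S' => σ.asModuleEquiv ((z : S') : σ.asModule)) h2
      simp only [Submodule.coe_smul, Representation.asModuleEquiv_map_smul, Representation.asAlgebraHom_single, one_smul,
        Algebra.algebraMap_eq_smul_one, map_smul, map_one] at h3
      simpa only [LinearMap.smul_apply, Module.End.one_apply] using h3
    have hevM : v' ∈ M :=
      le_iSup (fun y : κ => ⨅ i, Module.End.eigenspace (σ (s i)) ((χ₁ ∘ ⇑(π y).symm) i)) y
        ((Submodule.mem_iInf _).2 fun i => Module.End.mem_eigenspace_iff.2 (hev i))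
    have hevN : σ.asModuleEquiv.symm v' ∈ N := hN.2 hevM
    have hevN' : σ.asModuleEquiv.symm v' ∈ N' := by
      show σ.asModuleEquiv.symm (σ.asModuleEquiv ((e vS : S') : σ.asModule)) ∈ N'
      rw [LinearEquiv.symm_apply_apply]
      exact hS'N' (e vS).2
    have hzero : σ.asModuleEquiv.symm v' = 0 := by
      have hmem : σ.asModuleEquiv.symm v' ∈ N ⊓ N' := ⟨hevN, hevN'⟩
      rwa [hNN'.inf_eq_bot, Submodule.mem_bot] at hmem
    have he0 : e vS = 0 := by
      apply Subtype.ext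
      have h : ((e vS : S') : σ.asModule) = σ.asModuleEquiv.symm v' := (LinearEquiv.symm_apply_apply σ.asModuleEquiv _).symm
      rw [h, hzero, ZeroMemClass.coe_zero]
    have hvS0 : vS = 0 := e.injective (by rw [he0, map_zero])
    have : σ.asModuleEquiv.symm v = 0 := congrArg Subtype.val hvS0
    rw [LinearEquiv.map_eq_zero_iff] at this
    exact hv0 this
  -- conclusion: `C_{χ₂}` meets `M = ⊤`
  obtain ⟨w, hw, hw0⟩ := Submodule.exists_mem_ne_zero_of_ne_bot h₂
  have hwM : w ∈ M := hN.1 (by rw [hNtop]; exact Submodule.mem_top)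
  exact exists_eq_orbit_of_mem_iSup σ s π hcomm hfin χ₁ hwM hw hw0

end OneOrbit

/-! ## §3 Docking lemma: an isotypic component carries an isotypic restricted representation -/

section Docking

variable {W : Type*} [AddCommGroup W] [Module k W] (τ : Representation k Q W)

/-- **The representation restricted to an isotypic component is isotypic**: for `c ∈ isotypicComponents k[Q] (τ.asModule)` (★ L2″ ∕ ★ p855602's HF data), the restricted representation
`(Subrepresentation.ofSubmodule' c).toRepresentation` on `c` has `IsIsotypic k[Q]` module — the identity map `c → c` is a `k[Q]`-linear equivalence between Mathlib's two avatars of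
`c` (as a submodule of `τ.asModule`, and as the `asModule` of the restricted representation), and isotypy transports (Mathlib `IsIsotypic.isotypicComponents`, `LinearEquiv.isIsotypic_iff`).
[cite: Serre1977, §2.6 Thm. 8] -/
theorem isIsotypic_asModule_toRepresentation_ofSubmodule' {c : Submodule (MonoidAlgebra k Q) τ.asModule}
    (hc : c ∈ isotypicComponents (MonoidAlgebra k Q) τ.asModule) :
    IsIsotypic (MonoidAlgebra k Q) (Subrepresentation.ofSubmodule' c).toRepresentation.asModule := by
  let σ' := (Subrepresentation.ofSubmodule' c).toRepresentation
  -- the identity `c → σ'.asModule` as a `k`-linear map commuting with `single g 1 •`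
  let f : c →ₗ[k] σ'.asModule :=
    { toFun := fun x => σ'.asModuleEquiv.symm ⟨(x : τ.asModule), x.2⟩
      map_add' := fun x y => by rw [← map_add]; rfl
      map_smul' := fun a x => by
        rw [RingHom.id_apply, ← map_smul]
        congr 1 }
  have hf : ∀ (g : Q) (x : c), f (MonoidAlgebra.single g (1 : k) • x) = MonoidAlgebra.single g (1 : k) • f x := fun g x => by
    apply σ'.asModuleEquiv.injective
    simp only [f, LinearMap.coe_mk, AddHom.coe_mk, Representation.single_smul, one_smul, LinearEquiv.apply_symm_apply]
    apply Subtype.ext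
    show ((MonoidAlgebra.single g (1 : k) • x : c) : τ.asModule) = _
    rw [Submodule.coe_smul, Representation.single_smul, one_smul]
    rfl
  let F := MonoidAlgebra.equivariantOfLinearOfComm f hf
  have hFbij : Function.Bijective F := by
    constructor
    · intro x y hxy
      have h := congrArg σ'.asModuleEquiv hxy
      simp only [F, MonoidAlgebra.equivariantOfLinearOfComm_apply, f, LinearMap.coe_mk, AddHom.coe_mk, LinearEquiv.apply_symm_apply] at h
      exact Subtype.ext (congrArg Subtype.val h)
    · intro y
      refine ⟨⟨((σ'.asModuleEquiv y : (Subrepresentation.ofSubmodule' c).toSubmodule) : W), (σ'.asModuleEquiv y).2⟩, ?_⟩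
      simp only [F, MonoidAlgebra.equivariantOfLinearOfComm_apply, f, LinearMap.coe_mk, AddHom.coe_mk]
      rw [LinearEquiv.symm_apply_eq]
  exact (LinearEquiv.ofBijective F hFbij).isIsotypic_iff.1 (IsIsotypic.isotypicComponents hc)

end Docking

end Summit.HodgeConjecture.HodgeConjecture.Cruxes.H413.K2E3AbelianLayerClifford

end
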